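import Summits.BirchSwinnertonDyer.BirchSwinnertonDyer.Theorems.TameQuarticManinParityTameThreeOfColength
import Summits.BirchSwinnertonDyer.BirchSwinnertonDyer.Theorems.TameQuarticManinParityManinUnitIffTameColengthBound
import Summits.BirchSwinnertonDyer.BirchSwinnertonDyer.Theorems.TameQuarticManinParityIIIHasTameGoodModel
import Summits.BirchSwinnertonDyer.BirchSwinnertonDyer.Theorems.TameQuarticManinParityIrrThreeDvdDegreeOfCells
import Summits.BirchSwinnertonDyer.BirchSwinnertonDyer.Theorems.TameQuarticManinParityRedThreeDvdDegreeOfCells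
import Summits.BirchSwinnertonDyer.BirchSwinnertonDyer.Theorems.TameQuarticManinParityDegreeSplitGlue
import HarnessLib

/-!
# Route `TameQuarticManinParity` after LINE 41: the Manin binder reads «E57′ ∧ COL(III) ∧ carrier existence»
# (`--supports` E41, stmt-BirchSwinnertonDyer-24070; bookkeeping corollaries, nothing of record closes)

Cell `pub/bsd-wall`, D-0145 line `route-BirchSwinnertonDyer-TeichmullerTwistDescent`, seat `bsd-line-ttd-p1` g15.
BSD is NOT proved by this; Manin's conjecture at `3` is not proved by this; the cruxes E57′
(`TprimeTameStarredOptimalManinUnit`, stmt-24046) and COL(III) (`TprimeIIIColengthBound`, stmt-24044) stay OPEN and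
the carrier existence `nonempty_tameNeronFormsAt` is a displayed hypothesis (named fact, cite-only). THEOREMS ONLY.

With N38c (p696779), S41 (`IIIGoodModel.tprimeIIIHasTameGoodModel_proof`) and the glues G41a/G41irr/G41red
(p696800/p696817/p696850) landed, the discharged hypotheses are substituted BY NAME:

* `tprimeTameThreeOptimalManinUnit_of_colIII` — **E41 ⟸ COL(III) ∧ `nonempty_tameNeronFormsAt`**;
* `tprimeIrrManinUnitOfThreeDvdDegree_of_cells` — organ 24498 ⟸ E57′ ∧ COL(III) ∧ fact;
* `tprimeRedManinUnitOfThreeDvdDegree_of_cells` — hard half 24627 ⟸ E57′ ∧ COL(III) ∧ fact;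
* `tprimeReducibleManinUnit_of_cells_of_cns` — reducible organ 23737 ⟸ E57′ ∧ COL(III) ∧ fact ∧ ČNS half (24628),
  through the landed degree-split glue `tprimeRedOfDegreeSplit_proof`.

So after LINE 41 the route's two Manin organs depend on exactly two cell statements (III*: E57′; III: COL(III)) plus
the Néron-cotangent carrier; P/O22/ML/MD, E/D/61, K19 and E19/U19/F19 are off the critical path (planner's cone note).
-/

set_option autoImplicit false
-- D-0017: single-problem summit, so `Summit.BirchSwinnertonDyer.BirchSwinnertonDyer.…` repeats a namespace BY DESIGN.
set_option linter.dupNamespace false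

namespace Summit.BirchSwinnertonDyer.BirchSwinnertonDyer.Theorems.TameQuarticManinParity

open Summit.BirchSwinnertonDyer.BirchSwinnertonDyer.Theses.TameQuarticManinParity
open Literature.NumberTheory.EllipticCurves.ModularForms

/-- **E41 from the crux COL(III) and the carrier existence alone**: N38c (`maninUnitIffTameColengthBound_proof`)
and S41 (`IIIGoodModel.tprimeIIIHasTameGoodModel_proof`) are theorems of the tree, so G41a's first two hypotheses
are discharged by name. [cite: EdixhovenManin1991, §4 Prop. 8] -/
theorem tprimeTameThreeOptimalManinUnit_of_colIII (h44 : TprimeIIIColengthBound)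
    (hne : nonempty_tameNeronFormsAt) : TprimeTameThreeOptimalManinUnit :=
  tprimeTameThreeOfColength_proof maninUnitIffTameColengthBound_proof IIIGoodModel.tprimeIIIHasTameGoodModel_proof
    h44 hne

/-- **The irreducible organ (stmt-24498) from the two cells**: E57′ (III*) and COL(III) (III) with the carrier
existence, via G41irr. [cite: SilvermanATAEC1994, IV.9.4 and Table 4.1] -/
theorem tprimeIrrManinUnitOfThreeDvdDegree_of_cells (h57 : TprimeTameStarredOptimalManinUnit)
    (h44 : TprimeIIIColengthBound) (hne : nonempty_tameNeronFormsAt) : TprimeIrrManinUnitOfThreeDvdDegree :=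
  tprimeIrrThreeDvdDegreeOfCells_proof h57 (tprimeTameThreeOptimalManinUnit_of_colIII h44 hne)

/-- **The reducible hard half (stmt-24627) from the two cells**, via G41red.
[cite: SilvermanATAEC1994, IV.9.4 and Table 4.1] -/
theorem tprimeRedManinUnitOfThreeDvdDegree_of_cells (h57 : TprimeTameStarredOptimalManinUnit)
    (h44 : TprimeIIIColengthBound) (hne : nonempty_tameNeronFormsAt) : TprimeRedManinUnitOfThreeDvdDegree :=
  tprimeRedThreeDvdDegreeOfCells_proof h57 (tprimeTameThreeOptimalManinUnit_of_colIII h44 hne)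

/-- **The whole reducible organ `TprimeReducibleManinUnit` (stmt-23737) from the two cells and the ČNS half**
(`TprimeRedManinUnitOfDegreePrimeToThree`, 24628), through the landed degree-split glue `tprimeRedOfDegreeSplit_proof`.
[cite: CesnaviciusNeururerSaha2023, Thm. 1.2] -/
theorem tprimeReducibleManinUnit_of_cells_of_cns (h57 : TprimeTameStarredOptimalManinUnit)
    (h44 : TprimeIIIColengthBound) (hne : nonempty_tameNeronFormsAt)
    (hCNS : TprimeRedManinUnitOfDegreePrimeToThree) : TprimeReducibleManinUnit :=
  tprimeRedOfDegreeSplit_proof (tprimeRedManinUnitOfThreeDvdDegree_of_cells h57 h44 hne) hCNS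

end Summit.BirchSwinnertonDyer.BirchSwinnertonDyer.Theorems.TameQuarticManinParity
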